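import Summits.QuantumFields.BalabanUV.Beta.FP.WoundEvenFamilyTorus

/-!
# `BalabanUV.Beta.FP.TowerDoorSlotLetters` — road «FP», binder row D1, ROUTE T (β1): **THE N-SLOT LETTERS OF A FED SECOND-ORDER FAMILY `W♮ + 𝒲Δ`** — what the named
# tower law `TowerKernelLawNamedC` asks of its second-order N-family (`hWN` bi-localisation, `hWNw` winding, parities `hWNm hWNt`, the identifications `hHN₂ hQN₂` on the
# torus face `perF T (dper T (source-wound family))`) SPLITS ADDITIVELY over a sum of two swap-symmetric `VertexFamily₂` families, and a door WITHOUT MULTIPLIER LEGS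
# contributes NOTHING off the `ff` block (V10-PLAN §2 (b) «CHECK FIRST»; journal l.68647; an2's pin (β): the door is `ff`-only)

WHY.  v10 feeds NamedC the N-family `WN♮ + 𝒲Δ` (SPEC-64 §3 (ii-A)); v9 discharges every N-slot letter for `WN♮` (an2 PART 12∕15c∕18∕20∕23, road `TowerNParityRowsEven` ∕
`WoundEvenFamilyParities`); the door's shares are: bi-localisation ⟸ `hWΔ₂` (additive, `KernelWard.biLoc_add`); winding ⟸ PART 15c `winding_letter_of_swap` at the door's
`VertexFamily₂` letter + its SWAP SYMMETRY (§3); parities and the Q-row ⟸ the door has no multiplier legs (§2); all after the torus face is split (§1: `dper_add_of_biLoc₂` +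
`perF_add`, the wound sums bi-localised by PART 18 `biLoc_wound_sum`).  §4: the fed kernel law returns to the record's family: `hessKer A V (W♮ + 𝒲Δ) = hessKer A V (W + 𝒲Δ)`
pointwise (`tadpole_add`, road `SecondOrderTableEvenPart.tadpole_evenHalf`).

WHAT ([folklore] bookkeeping BY NAME; generic dimension `d`, fibre `Fib d`; no `def`, no `def … : Prop`, nothing cited, 0 sorry):
§1 `perF_dper_add_of_biLoc₂`, **`perF_dper_evenWound_add_wound`** (torus `M = N·M′`, two swap-symmetric `VertexFamily₂` families: the torus face of «source-wound even `W₁` +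
source-wound `W₂`» is the sum of the two faces), `perF_dper_evenHalf_add` (the unwound members); §2 `perF_dper_wound_eq_zero_of_inr_left ∕ _right`, `submatrix_perF_dper_wound_eq_zero_of_inr`
(a leg-free family's wound face vanishes on every multiplier row∕column); §3 **`winding_evenWound_add_wound`** (NamedC's `hWNw` SHAPE for the fed family, discharged: the two PART 15c windings added);
§4 **`hessKer_evenHalf_add_apply`** (`hessKer A V (x ↦ W♮ x + D x) μ ν z = hessKer A V (W + D) μ ν z` for a spread sgn-symmetric leg and localised members).
WHAT THIS IS NOT: no row of v10 typed here (the road instantiates); the door is an ABSTRACT family — NOT defined, valued, claimed inhabited or zero; nothing of Bałaban's asserted,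
valued or discharged; 0 estimates beyond [folklore] geometric series BY NAME; 0∕4 row-D1 binders (hW, hR, D1Tel, D1Rep); ROOT M‴ p325680 ∕ P5c ∕ D6 untouched; NOT (C1), NOT (T-ID),
NOT D1, NEVER «G-an2-4 closed», NOT BetaPertH, NOT continuum, NOT Clay.

HONEST DEPENDENCY (page 1, mandatory): continuum YM on T⁴ ⇐ BetaPertH ∧ nine spine estimates (0/9 proved); BetaPertH ⇐ (D1) ∧ (D4) ∧ CAP+tail;
G-an2-4 gates asym, D1 and NE2/3/4.  HONEST FRAMING (cell contract, verbatim): «discharging `BetaPertH` makes Bałaban's UV stability UNCONDITIONAL —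
a real constructive-QFT result; it is NOT the continuum limit and NOT the Clay problem.»  ABSOLUTE RULE (cell charter, verbatim): «No internally-minted
statement may enter as a cited fact. Every hypothesis is either kernel-proved in this package or a verbatim quotation of a PUBLISHED theorem with page
reference. The manuscript(s) under audit are NOT citable for their own disputed steps — they are the thing under adjudication; programme-internal
(2001/route/tribunal) claims are never citable.»  Road «FP» OWNER, b2b-balaban-beta-d1-p3 gen 53, 2026-08-28.  No existing file touched.
-/

noncomputable section

open scoped BigOperators Matrix Topology
open Finset Filter

namespace Summit.QuantumFields.BalabanUV.Beta.FP.TowerDoorSlotLetters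

open Literature.MathematicalPhysics.QuantumFieldTheory.Balaban1983to89
open Literature.MathematicalPhysics.QuantumFieldTheory.Balaban1983to89.Beta
open B12Sec2to5 (l1 l1_nonneg)
open B4TorusKernel.MultiPeriod (translate)
open B4Sect5Proof (latticeConst latticeConst_nonneg)
open B6Lemma24Torus (pbox)
open ExpKernelCalculus (MKer Decays BiLoc VertexFamily₂ hessKer tadpole)
open OneStepResolventKernel (Fib biLoc_mono)
open KernelWard (biLoc_add)
open Summit.QuantumFields.BalabanUV.Beta.TameKernelCalculus (trK Spr Loc tadpole_add)
open Summit.QuantumFields.BalabanUV.Beta.BorderedHessian (sgnK)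
open Summit.QuantumFields.BalabanUV.Beta.GAN24.SecondOrderCarrierParity (vertexFamily₂_evenHalf_of_swap)
open Summit.QuantumFields.BalabanUV.Beta.FP.KernelPeriodisationFib (Idx perF perF_apply perZ_apply perF_add)
open Summit.QuantumFields.BalabanUV.Beta.FP.KernelPeriodisationFibLoc (dper dper_apply decays_dper)
open Summit.QuantumFields.BalabanUV.Beta.FP.KernelPeriodisationFibWoundLetter (evenHalf_swap winding_letter_of_swap winding_letter_evenHalf_of_swap)
open Summit.QuantumFields.BalabanUV.Beta.FP.SecondOrderTableEvenPart (dper_add_of_biLoc₂ loc_of_biLoc loc_evenHalf tadpole_evenHalf)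
open Summit.QuantumFields.BalabanUV.Beta.FP.WoundEvenFamilyTorus (biLoc_wound_sum)

variable {d : ℕ}

/-! ## §1 The torus face `perF M ∘ dper M` is additive on bi-localised kernels; the two wound families of a fed N-slot -/

section Add

variable (M : Fin (d + 1) → ℕ) [∀ i, NeZero (M i)]

/-- [folklore] `perF M (dper M (V + V′)) = perF M (dper M V) + perF M (dper M V′)` for bi-localised `V`, `V′` (positive rates): `dper_add_of_biLoc₂` + `perF_add` at `decays_dper`. -/
theorem perF_dper_add_of_biLoc₂ {V V' : MKer (d + 1) (Fib d)} {p q p' q' : Fin (d + 1) → ℤ} {C δ C' δ' : ℝ}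
    (hV : BiLoc V p q C δ) (hC : 0 ≤ C) (hδ : 0 < δ) (hV' : BiLoc V' p' q' C' δ') (hC' : 0 ≤ C') (hδ' : 0 < δ') :
    perF M (dper M (V + V')) = perF M (dper M V) + perF M (dper M V') := by
  rw [dper_add_of_biLoc₂ M hV hC hδ hV' hC' hδ']
  exact perF_add M (decays_dper M hV hC hδ) (decays_dper M hV' hC' hδ') (half_pos hδ) (half_pos hδ')

variable {M' : Fin (d + 1) → ℕ} {N : ℕ}
  {W₁ W₂ : Fin (d + 1) → (Fin (d + 1) → ℤ) → Fin (d + 1) → (Fin (d + 1) → ℤ) → MKer (d + 1) (Fib d)} {C₁ δ₁ C₂ δ₂ : ℝ}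

/-- [folklore] **`perF_dper_evenWound_add_wound` — THE TORUS FACE OF THE FED WOUND FAMILY SPLITS**: on a box `M = N·M′`, for two swap-symmetric `VertexFamily₂` families
`W₁ W₂` (blocking `N`, positive rates), the face of «source-wound EVEN `W₁` + source-wound `W₂`» is the sum of the two faces (§1 at PART 18 `biLoc_wound_sum` for `W₁♮`
— swap-symmetric and `VertexFamily₂` by GAN24 `vertexFamily₂_evenHalf_of_swap` ∕ PART 15c `evenHalf_swap` — and for `W₂`). -/
theorem perF_dper_evenWound_add_wound (hM : ∀ i, M i = N * M' i)
    (hs₁ : ∀ μ y ν y', W₁ ν y' μ y = W₁ μ y ν y') (hW₁ : VertexFamily₂ W₁ N C₁ δ₁) (hδ₁ : 0 < δ₁)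
    (hs₂ : ∀ μ y ν y', W₂ ν y' μ y = W₂ μ y ν y') (hW₂ : VertexFamily₂ W₂ N C₂ δ₂) (hδ₂ : 0 < δ₂)
    (μ : Fin (d + 1)) (y : Fin (d + 1) → ℤ) (ν : Fin (d + 1)) (y' : Fin (d + 1) → ℤ) :
    perF M (dper M ((fun x w a b => ∑' e : Fin (d + 1) → ℤ, ((1 / 2 : ℝ) • (W₁ μ y ν (translate M' y' e) + sgnK (trK (W₁ μ y ν (translate M' y' e))))) x w a b)
        + (fun x w a b => ∑' e : Fin (d + 1) → ℤ, W₂ μ y ν (translate M' y' e) x w a b)))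
      = perF M (dper M (fun x w a b => ∑' e : Fin (d + 1) → ℤ, ((1 / 2 : ℝ) • (W₁ μ y ν (translate M' y' e) + sgnK (trK (W₁ μ y ν (translate M' y' e))))) x w a b))
        + perF M (dper M (fun x w a b => ∑' e : Fin (d + 1) → ℤ, W₂ μ y ν (translate M' y' e) x w a b)) := by
  have h₁ := biLoc_wound_sum M hM (W := fun μ y ν y' => (1 / 2 : ℝ) • (W₁ μ y ν y' + sgnK (trK (W₁ μ y ν y'))))
    (evenHalf_swap hs₁) (vertexFamily₂_evenHalf_of_swap hs₁ hW₁) hδ₁ μ y ν y'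
  have h₂ := biLoc_wound_sum M hM hs₂ hW₂ hδ₂ μ y ν y'
  have hC₁ : 0 ≤ C₁ := (hW₁ μ y ν y').nonneg (Sum.inl 0)
  have hC₂ : 0 ≤ C₂ := (hW₂ μ y ν y').nonneg (Sum.inl 0)
  exact perF_dper_add_of_biLoc₂ M h₁ (mul_nonneg hC₁ (latticeConst_nonneg _ (half_pos hδ₁).le)) (by positivity)
    h₂ (mul_nonneg hC₂ (latticeConst_nonneg _ (half_pos hδ₂).le)) (by positivity)

omit [∀ i, NeZero (M i)] in
/-- [folklore] **`perF_dper_evenHalf_add` — THE UNWOUND MEMBERS SPLIT**: `perF M (dper M (W₁♮ μ y ν y′ + W₂ μ y ν y′))` is the sum of the two faces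
(`VertexFamily₂` letters, positive rates; `W₁` swap-symmetric so that `W₁♮` is bi-localised at the same bonds). -/
theorem perF_dper_evenHalf_add [∀ i, NeZero (M i)]
    (hs₁ : ∀ μ y ν y', W₁ ν y' μ y = W₁ μ y ν y') (hW₁ : VertexFamily₂ W₁ N C₁ δ₁) (hδ₁ : 0 < δ₁)
    (hW₂ : VertexFamily₂ W₂ N C₂ δ₂) (hδ₂ : 0 < δ₂)
    (μ : Fin (d + 1)) (y : Fin (d + 1) → ℤ) (ν : Fin (d + 1)) (y' : Fin (d + 1) → ℤ) :
    perF M (dper M ((1 / 2 : ℝ) • (W₁ μ y ν y' + sgnK (trK (W₁ μ y ν y'))) + W₂ μ y ν y'))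
      = perF M (dper M ((1 / 2 : ℝ) • (W₁ μ y ν y' + sgnK (trK (W₁ μ y ν y'))))) + perF M (dper M (W₂ μ y ν y')) := by
  have h₁ := vertexFamily₂_evenHalf_of_swap hs₁ hW₁ μ y ν y'
  have hC₁ : 0 ≤ C₁ := (hW₁ μ y ν y').nonneg (Sum.inl 0)
  have hC₂ : 0 ≤ C₂ := (hW₂ μ y ν y').nonneg (Sum.inl 0)
  exact perF_dper_add_of_biLoc₂ M h₁ hC₁ hδ₁ (hW₂ μ y ν y') hC₂ hδ₂

end Add

/-! ## §2 A family without multiplier legs: its wound torus face vanishes on every multiplier row and column -/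

section LegFree

variable (M : Fin (d + 1) → ℕ) {M' : Fin (d + 1) → ℕ}
  {W₂ : Fin (d + 1) → (Fin (d + 1) → ℤ) → Fin (d + 1) → (Fin (d + 1) → ℤ) → MKer (d + 1) (Fib d)}

/-- [folklore] **no multiplier legs on the left ⟹ every multiplier ROW of the wound face vanishes** (NamedC's slot shape: the row index `p` has `p.2 = inr m`;
`perF`, `perZ`, `dper` unfolded: sums of zeros). -/
theorem perF_dper_wound_eq_zero_of_inr_left (hm : ∀ μ y ν y' x w (m : Fin (d + 1)) (b : Fib d), W₂ μ y ν y' x w (Sum.inr m) b = 0)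
    (μ : Fin (d + 1)) (y : Fin (d + 1) → ℤ) (ν : Fin (d + 1)) (y' : Fin (d + 1) → ℤ) (p q : Idx M (Fib d)) (hp : ∃ m : Fin (d + 1), p.2 = Sum.inr m) :
    perF M (dper M (fun x w a b => ∑' e : Fin (d + 1) → ℤ, W₂ μ y ν (translate M' y' e) x w a b)) p q = 0 := by
  obtain ⟨s, a⟩ := p
  obtain ⟨m, rfl⟩ := hp
  simp only [perF_apply, perZ_apply, dper_apply, hm, tsum_zero]

/-- [folklore] **no multiplier legs on the right ⟹ every multiplier COLUMN of the wound face vanishes** (`q.2 = inr m`). -/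
theorem perF_dper_wound_eq_zero_of_inr_right (hm' : ∀ μ y ν y' x w (a : Fib d) (m : Fin (d + 1)), W₂ μ y ν y' x w a (Sum.inr m) = 0)
    (μ : Fin (d + 1)) (y : Fin (d + 1) → ℤ) (ν : Fin (d + 1)) (y' : Fin (d + 1) → ℤ) (p q : Idx M (Fib d)) (hq : ∃ m : Fin (d + 1), q.2 = Sum.inr m) :
    perF M (dper M (fun x w a b => ∑' e : Fin (d + 1) → ℤ, W₂ μ y ν (translate M' y' e) x w a b)) p q = 0 := by
  obtain ⟨s, b⟩ := q
  obtain ⟨m, rfl⟩ := hq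
  simp only [perF_apply, perZ_apply, dper_apply, hm', tsum_zero]

/-- [folklore] **the `(μ-slots) × ff` submatrix of a leg-free family's wound face is zero** (NamedC's `hQN₂` shape: `fμ a` has `(fμ a).2 = inr m`). -/
theorem submatrix_perF_dper_wound_eq_zero_of_inr {κ ι : Type*} (fμ : κ → Idx M (Fib d)) (hμ : ∀ a : κ, ∃ m : Fin (d + 1), (fμ a).2 = Sum.inr m) (g : ι → Idx M (Fib d))
    (hm : ∀ μ y ν y' x w (m : Fin (d + 1)) (b : Fib d), W₂ μ y ν y' x w (Sum.inr m) b = 0)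
    (μ : Fin (d + 1)) (y : Fin (d + 1) → ℤ) (ν : Fin (d + 1)) (y' : Fin (d + 1) → ℤ) :
    (perF M (dper M (fun x w a b => ∑' e : Fin (d + 1) → ℤ, W₂ μ y ν (translate M' y' e) x w a b))).submatrix fμ g = 0 :=
  Matrix.ext fun a i => perF_dper_wound_eq_zero_of_inr_left M hm μ y ν y' (fμ a) (g i) (hμ a)

end LegFree

/-! ## §3 The winding letter of the fed family -/

section Winding

variable {A : MKer (d + 1) (Fib d)} {CA α : ℝ} {N : ℕ}
  {W₁ W₂ : Fin (d + 1) → (Fin (d + 1) → ℤ) → Fin (d + 1) → (Fin (d + 1) → ℤ) → MKer (d + 1) (Fib d)} {C₁ δ₁ C₂ δ₂ : ℝ}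

/-- [folklore] **`winding_evenWound_add_wound` — NamedC's WINDING LETTER `hWNw` FOR THE FED FAMILY `W₁♮ + W₂`, DISCHARGED**: torus boxes `T k = N·Mc k` and source
boxes `Mc k` growing, a decaying `T_kℤ`-invariant leg `A`, two swap-symmetric `VertexFamily₂` families (blocking `N ≥ 1`, positive rates); then
`trace (perF (T k) A * perF (T k) (dper (T k) (wound W₁♮ + wound W₂))) − trace (perF (T k) A * perF (T k) (dper (T k) (W₁♮ μ y ν z + W₂ μ y ν z))) → 0`
(§1's two splits per box, `Matrix.mul_add`, `Matrix.trace_add`, then PART 15c `winding_letter_evenHalf_of_swap` + `winding_letter_of_swap`, `Tendsto.add`). -/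
theorem winding_evenWound_add_wound (T Mc : ℕ → (Fin (d + 1) → ℕ)) [∀ k μ, NeZero (T k μ)] [∀ k μ, NeZero (Mc k μ)]
    (hT : ∀ K : ℕ, ∀ᶠ k in atTop, ∀ i, K ≤ T k i) (hMc : ∀ K : ℕ, ∀ᶠ k in atTop, ∀ i, K ≤ Mc k i) (hTM : ∀ k i, T k i = N * Mc k i)
    (hA : Decays A CA α) (hα : 0 < α)
    (hAinv : ∀ k (m x y : Fin (d + 1) → ℤ) (a b : Fib d), A (translate (T k) x m) (translate (T k) y m) a b = A x y a b)
    [NeZero N] (hs₁ : ∀ μ y ν y', W₁ ν y' μ y = W₁ μ y ν y') (hW₁ : VertexFamily₂ W₁ N C₁ δ₁) (hδ₁ : 0 < δ₁)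
    (hs₂ : ∀ μ y ν y', W₂ ν y' μ y = W₂ μ y ν y') (hW₂ : VertexFamily₂ W₂ N C₂ δ₂) (hδ₂ : 0 < δ₂)
    (μ : Fin (d + 1)) (y : Fin (d + 1) → ℤ) (ν : Fin (d + 1)) (z : Fin (d + 1) → ℤ) :
    Tendsto (fun k => Matrix.trace (perF (T k) A * perF (T k) (dper (T k)
          ((fun x w a b => ∑' e : Fin (d + 1) → ℤ, ((1 / 2 : ℝ) • (W₁ μ y ν (translate (Mc k) z e) + sgnK (trK (W₁ μ y ν (translate (Mc k) z e))))) x w a b)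
            + (fun x w a b => ∑' e : Fin (d + 1) → ℤ, W₂ μ y ν (translate (Mc k) z e) x w a b))))
        - Matrix.trace (perF (T k) A * perF (T k) (dper (T k) ((1 / 2 : ℝ) • (W₁ μ y ν z + sgnK (trK (W₁ μ y ν z))) + W₂ μ y ν z)))) atTop (𝓝 0) := by
  have h₁ := winding_letter_evenHalf_of_swap T Mc hT hMc hA hα hAinv hs₁ hW₁ hδ₁ μ y ν z
  have h₂ := winding_letter_of_swap T Mc hT hMc hA hα hAinv hs₂ hW₂ hδ₂ μ y ν z
  have h := h₁.add h₂
  rw [add_zero] at h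
  refine h.congr' (Eventually.of_forall fun k => ?_)
  dsimp only
  rw [perF_dper_evenWound_add_wound (T k) (hTM k) hs₁ hW₁ hδ₁ hs₂ hW₂ hδ₂ μ y ν z,
    perF_dper_evenHalf_add (T k) hs₁ hW₁ hδ₁ hW₂ hδ₂ μ y ν z, Matrix.mul_add, Matrix.mul_add, Matrix.trace_add, Matrix.trace_add]
  ring

end Winding

/-! ## §4 The fed kernel law returns to the record's family: the even half is invisible next to the door -/

section HessKer

variable {A : MKer (d + 1) (Fib d)}
  {W D : Fin (d + 1) → (Fin (d + 1) → ℤ) → Fin (d + 1) → (Fin (d + 1) → ℤ) → MKer (d + 1) (Fib d)}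

/-- [folklore] **`hessKer_evenHalf_add_apply`**: for a spread sgn-symmetric leg `A` (`trK A = sgnK A`) and localised members `W μ 0 ν z`, `D μ 0 ν z`,
`hessKer A V (x ↦ W♮ x + D x) μ ν z = hessKer A V (W + D) μ ν z` (`hessKer = ½·tadpole − ½·bubble`; `tadpole_add`; `tadpole_evenHalf`). -/
theorem hessKer_evenHalf_add_apply (hA : Spr A) (hAt : trK A = sgnK A) (V : Fin (d + 1) → (Fin (d + 1) → ℤ) → MKer (d + 1) (Fib d))
    (μ ν : Fin (d + 1)) (z : Fin (d + 1) → ℤ) (hW : Loc (W μ 0 ν z)) (hD : Loc (D μ 0 ν z)) :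
    hessKer A V (fun μ y ν y' => (1 / 2 : ℝ) • (W μ y ν y' + sgnK (trK (W μ y ν y'))) + D μ y ν y') μ ν z = hessKer A V (W + D) μ ν z := by
  simp only [ExpKernelCalculus.hessKer, Pi.add_apply]
  rw [tadpole_add hA (loc_evenHalf hW) hD, tadpole_add hA hW hD, tadpole_evenHalf hA hAt hW]

end HessKer

end Summit.QuantumFields.BalabanUV.Beta.FP.TowerDoorSlotLetters

end
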